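import Literature.MathematicalPhysics.QuantumFieldTheory.Balaban1983to89.B4BoxCov237
import Literature.MathematicalPhysics.QuantumFieldTheory.Balaban1983to89.B1Eq324BenfattoClassEntryFromCovarianceUniform
import HarnessLib

/-!
# `Balaban1983to89.B1Eq324BenfattoClassBoxFluctuation` — THE SECOND CAPSTONE INSTANCE of the class road: [Balaban1982Higgs1] (3.24) for the
# Gaussian field of [Balaban1983RegularityDecay]'s box fluctuation covariance `C_Λ^{(k)}(□) = ((Δ^{(k)}(□) + aL^{-2}P)|_Λ)^{-1}` at ZERO BACKGROUND
# (`A = 0`), EVERY step `k`, EVERY Neumann box `□` built of `L`-blocks, EVERY `Λ ⊆ □^{(k)}`, EVERY coupling `η ∈ (0,1]` — UNCONDITIONAL, no definition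

statement-level companion of a published source with citation tags; every declaration here is a theorem; nothing here is
a claim about the Yang–Mills mass gap

WHY THIS MODULE (cell `pub-ymgap`, seat `dag-n08-d` gen 16, CLAIM-74; node N08 [Balaban1985UV3]; the [BenfattoEtAl1978] source chain behind the
(α)-row `h324`).  The class road of this cell (≈ 60 modules; seats n08-b / n08-c / n08-d / n08-w4 / n08-w5) proves [Balaban1982Higgs1] (3.24) for the
Gaussian field `𝒩(0, K)` of every CLASS MEMBER `(Λ, A, K)` — a finite window `Λ ⊂ ℤ^d`, a symmetric uniformly elliptic precision `A` with
exponentially decaying entries, `K` = `A⁻¹` extended by zero — with the member data as HYPOTHESES (`…KernelEq324AnyGamma.eq324_kernel_of_expDecay`,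
`…KernelEq324AnyGammaUnitRange.eq324_kernel_of_expDecay_on_unit`).  Seat n08-b's `…ClassTorusLaplacian` (the first capstone instance) ran the road
end to end on the massive free field of the discrete torus.  THIS FILE runs it on a printed RENORMALISATION-GROUP covariance of Bałaban's: the
`k`-th step fluctuation covariance of [Balaban1983RegularityDecay] p. 573 (1.13), `C_Λ^{(k)}(Ω, A) = ((Δ^{(k)}(Ω, A) + aL^{−2}P(A))|_Λ)^{−1}`, for
`Ω = □` a rectangular parallelepiped built of `L`-blocks with Neumann boundary conditions and the background gauge field `A = 0` — the lineage
`B4BoxCov237` (N01 [B4], HYPOTHESIS-FREE) types `(Δ^{(j)}(□) + aL^{-2}P)|_Λ` as `covOpSub n ℓ a_j a m_j² M′ ι_Λ` (`n = L^j` fine points per unit length,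
`L = ℓ + 1 ≥ 2`, parameter window `a_j ∈ [a₋, a₊]`, `m_j² ∈ [0, m²₊]`, `a ∈ [a₂₋, a₂₊]`) and certifies, with constants depending on `d`, `ℓ` and the
window ONLY (uniform in the step `j`, the box and `Λ`): symmetry, the coercivity `γ₀` of (1.15) (`covOp_hyp56`, via the block Poincaré
inequality of `Beta.CoordCubePoincare` / `Beta.BlockPoincare`), the entry decay of `Δ^{(j)}(□) + aL^{-2}P` (`covOp_hyp56`, sup norm), the inverse's
decay (1.16) (`cov116_box_sub_decay`) and the form bounds (1.15) (`cov237_box_form_bounds`).  That is EXACTLY the member data the class road reads —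
so (3.24) holds for `𝒩(0, C_Λ^{(j)}(□))`, every `j`, box, `Λ`, by ONE `obtain` (§3).  In [Balaban1982Higgs1]'s own setting (3.24) is stated for the
scalar field's fluctuation measure `dμ_{C^{(k)}}` at a background gauge field; at zero background on a box that covariance IS (1.13) — so this is the
scalar-sector, zero-background, Neumann-box case of the printed (3.24)'s Gaussian measure, with the interaction in the class road's generic
(4.5)-Hamiltonian / `cutoffBoltzmann` letters.

WHAT IS PROVED (theorems only; no definition, no named fact, no `sorry`; axioms standard).
* §1 glue (private): `exp_neg_supNorm_le_exp_neg_euclid` (`e^{−κ|y−y′|_∞} ≤ e^{−(κ/√(d+1))|y−y′|₂}` on `ℤ^{d+1}`), `sum_mul_mulVec_eq_sum_sum`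
  (`Σ_e v_e (Av)_e = Σ_{e,e′} A_{ee′} v_e v_{e′}`), `inclusion_injective`; §4's `submatrix_form_le_of_form_le` (private).
* §2 ★★ `boxFluctuation_classMember` — for every dimension `d + 1`, block size `L = ℓ + 1 ≥ 2` and window there are `γ_A > 0`, `K_A ≥ 0`, `κ_A > 0`
  (from `(d, ℓ, window)` ONLY) such that for EVERY `n ≥ 1`, admissible `(a_j, m_j², a)`, box `M′` and `Λ ⊆ □^{(j)}` the precision
  `A_Λ := (Δ^{(j)}(□) + aL^{-2}P)|_Λ = covOpSub … ι_Λ : Matrix Λ Λ ℝ` is symmetric, `γ_A`-coercive in the class binder shape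
  `γ_A Σ_e x_e² ≤ Σ_{e,e′} A_{ee′} x_e x_{e′}` and `|A_Λ e e′| ≤ K_A e^{−κ_A|e−e′|₂}` — the three member rows of `eq324_kernel_of_expDecay(_on_unit)`,
  UNIFORMLY IN THE STEP (`κ_A = κ/√(d+1)` with `B4BoxCov237.covOp_hyp56`'s sup-norm rate `κ`).
* §3 ★★★ `eq324_boxFluctuation_on_unit` — for the same data and every order `t`, degree `D`, tree rate `ϰ > 0`, rate letters `p₀ > 2/3`, `σ > 0`,
  `c ≥ 0`, `0 < κ < σ(t+1)`: `∃ b₁ ∀ b₀ > b₁ ∃ C ≥ 0 ∀ η ∈ (0,1] ∀ n ≥ 1 ∀ (a_j, m_j², a)` admissible `∀` box `∀ Λ ⊆ □^{(j)}` (`Λ ≠ ∅`) `∀ K` = `C_Λ^{(j)}(□) =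
  (covOpSub … ι_Λ)⁻¹` extended by zero `∀ (s, J ⊆ I, J ⊆ Λ, 𝔄)` with `I ≠ ∅`, `sup|𝔄| ≤ c·η^σ`:
  `0 < ∫Π_Δχ̂_{I,p(η)}e^{H_J}d𝒩(0,K) ∧ |log ∫Π_Δχ̂_{I,p(η)}e^{H_J}d𝒩(0,K) − Σ_{k≤t}𝓔^T(H_J;k)/k!| ≤ C·η^κ·|I|` — seat n08-b's
  `eq324_kernel_of_expDecay_on_unit` conclusion VERBATIM at dimension `d + 1`, its member hypotheses DISCHARGED by §2;
  ★★★ `eq324_boxFluctuation` — the `η₀`-window edition (`∃ η₀ ∈ (0,1], C ≥ 0, ∀ η ≤ η₀ …`) over `eq324_kernel_of_expDecay`.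
* §4 ★★ `boxFluctuation_classCovariance` — the COVARIANCE column's rows for `G_Λ := C_Λ^{(j)}(□) = (covOpSub … ι_Λ)⁻¹`, window-uniform scalars
  `(g, Λ_G, K_G, κ_G)`: `A_Λ·G_Λ = 1`, `G_Λ` symmetric, `g`-coercive, `Λ_G`-bounded, `|G_Λ e e′| ≤ K_G e^{−κ_G|e−e′|₂}` — (1.15)–(1.16)|_Λ at `A = 0` in the
  currency of seat n08-w5's `…ClassEntryFromCovarianceUniform.eq324_covariance_of_expDecay_on_unit` (over `GaussianToolkit.inv_form_bounds`,
  `cov237_box_form_bounds`, `covOpSub_form_ge`, `cov116_box_sub_decay`; the upper form bound is transported to the compression along the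
  extension by zero, private `submatrix_form_le_of_form_le`); `eq324_boxFluctuation_cov_on_unit` — §3's conclusion re-derived through that door (the two
  doors agree).
* Non-vacuity `example`s at `d + 1 = 4`, `L = 2`, window `a_j ∈ [½, 2]`, `m_j² ∈ [0, 1]`, `a ∈ [½, 2]`.

HONEST SCOPE / NOT HERE.  A composition BY NAME of two certified lineages (N01 [B4]'s hypothesis-free `B4BoxCov237` × the N08 class road); no
estimate is re-proved.  The member is the SCALAR-sector fluctuation covariance at ZERO background (`A = 0`, `U ≡ 1`) on a Neumann BOX `□` (not a
general `Ω`; `Λ` arbitrary inside `□^{(j)}` — more than the print's «Λ being a sum of big blocks», harmless at `A = 0`); it is NOT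
[Balaban1985UV3]'s gauge-field fluctuation operator `C*Δ_kC` at a general background (the N06 [Balaban1985BackgroundPropagators] Sect. E in-edge),
NOT the torus (seat n08-b's bent window `…ClassTorusWindow` serves wrapped regions), and NOT the IDENT: which (4.5)-Hamiltonian `H_J` / which
cut-offs present [Balaban1982Higgs1]'s `𝒱` and `χ` is class II and stays in the road's generic letters (`hamiltonian s D ϰ 𝔄 J`, `cutoffBoltzmann`);
the threshold window `b₁ < b₀` of §3 is displayed, not decided.  IDENT NOT commissioned / NOT claimed; nothing of [Balaban1985UV3] / [Balaban1985UV2]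
/ [BenfattoEtAl1978] is asserted or discharged; `PrintedUV3V` NOT proved; N08 is NOT discharged by this file; count-neutral; nothing about d = 4
specifically, the continuum, OS axioms, a mass gap or the Clay problem.
-/

noncomputable section

open MeasureTheory Finset Matrix
open scoped BigOperators

namespace Literature.MathematicalPhysics.QuantumFieldTheory.Balaban1983to89.B1Eq324BenfattoClassBoxFluctuation

open Literature.MathematicalPhysics.QuantumFieldTheory
open Literature.MathematicalPhysics.QuantumFieldTheory.Balaban1983to89.B1Eq324BenfattoLemma
open Literature.MathematicalPhysics.QuantumFieldTheory.Balaban1983to89.B4ContourShift (supNorm abs_le_supNorm supNorm_nonneg)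
open Literature.MathematicalPhysics.QuantumFieldTheory.Balaban1983to89.B4Reflection242 (boxDom)
open Literature.MathematicalPhysics.QuantumFieldTheory.Balaban1983to89.B4Sect5Torus (Hyp56 hyp56_submatrix sum_eq_sum_range)
open Literature.MathematicalPhysics.QuantumFieldTheory.Balaban1983to89.B4BoxCov237
  (covOp covOpSub covOpSub_apply rho covOp_hyp56 cov116_box_sub_decay cov237_box_form_bounds covOpSub_form_ge)
open Literature.MathematicalPhysics.QuantumFieldTheory.Balaban1983to89.B1Eq324BenfattoKernelEq324AnyGamma (eq324_kernel_of_expDecay)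
open Literature.MathematicalPhysics.QuantumFieldTheory.Balaban1983to89.B1Eq324BenfattoKernelEq324AnyGammaUnitRange
  (eq324_kernel_of_expDecay_on_unit)
open Literature.MathematicalPhysics.QuantumFieldTheory.Balaban1983to89.B1Eq324BenfattoClassEntryFromCovarianceUniform
  (eq324_covariance_of_expDecay_on_unit)
open Literature.MathematicalPhysics.QuantumFieldTheory.Balaban1983to89.B1Eq324BenfattoClassEntryFromCovariance (inv_symm_of_coercive)
open Literature.MathematicalPhysics.QuantumFieldTheory.Balaban1983to89.B1Eq324BenfattoClassAppendixC (posDef_of_coercive)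
open Literature.MathematicalPhysics.QuantumFieldTheory.GaussianToolkit (inv_form_bounds)

variable {d : ℕ}

/-! ## §1  Glue: sup norm versus Euclidean norm on `ℤ^{d+1}`, the class form shape, the inclusion of a window into the unit box -/

/-- On `ℤ^{d+1}`, `|x|₂ ≤ √(d+1)·|x|_∞`; hence a sup-norm decay at rate `κ ≥ 0` is a Euclidean decay at rate `κ/√(d+1)`:
`e^{−κ|y−y′|_∞} ≤ e^{−(κ/√(d+1))·|y−y′|₂}` (the class road measures distances in `|·|₂`, the [B4] lineage in `|·|_∞`). [folklore] -/
private theorem exp_neg_supNorm_le_exp_neg_euclid {κ : ℝ} (hκ : 0 ≤ κ) (y y' : Fin (d + 1) → ℤ) :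
    Real.exp (-(κ * supNorm (y - y'))) ≤
      Real.exp (-(κ / Real.sqrt (d + 1) * Real.sqrt (∑ j, ((y j : ℝ) - (y' j : ℝ)) ^ 2))) := by
  apply Real.exp_le_exp.mpr
  set x : Fin (d + 1) → ℤ := y - y' with hxdef
  have hx : ∀ j, (y j : ℝ) - (y' j : ℝ) = ((x j : ℤ) : ℝ) := fun j => by
    simp only [hxdef, Pi.sub_apply, Int.cast_sub]
  simp_rw [hx]
  -- `|x|₂ ≤ √(d+1)|x|_∞`
  have hsq : ∑ i, ((x i : ℝ)) ^ 2 ≤ (d + 1) * supNorm x ^ 2 := by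
    calc ∑ i, ((x i : ℝ)) ^ 2 ≤ ∑ _i : Fin (d + 1), supNorm x ^ 2 := by
          refine Finset.sum_le_sum fun i _ => ?_
          have h1 := abs_le_supNorm x i
          have h2 : ((x i : ℝ)) ^ 2 = (((|x i| : ℤ) : ℝ)) ^ 2 := by rw [Int.cast_abs, sq_abs]
          rw [h2]
          exact pow_le_pow_left₀ (by positivity) h1 2
      _ = (d + 1) * supNorm x ^ 2 := by simp [Finset.sum_const, Finset.card_univ, Fintype.card_fin]
  have hd : (0 : ℝ) < Real.sqrt (d + 1) := Real.sqrt_pos.mpr (by positivity)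
  have h2 : Real.sqrt (∑ i, ((x i : ℝ)) ^ 2) ≤ Real.sqrt (d + 1) * supNorm x := by
    rw [← Real.sqrt_sq (supNorm_nonneg x), ← Real.sqrt_mul (by positivity)]
    exact Real.sqrt_le_sqrt hsq
  have h3 : κ / Real.sqrt (d + 1) * Real.sqrt (∑ i, ((x i : ℝ)) ^ 2) ≤ κ * supNorm x := by
    calc κ / Real.sqrt (d + 1) * Real.sqrt (∑ i, ((x i : ℝ)) ^ 2)
        ≤ κ / Real.sqrt (d + 1) * (Real.sqrt (d + 1) * supNorm x) :=
          mul_le_mul_of_nonneg_left h2 (div_nonneg hκ hd.le)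
      _ = κ * supNorm x := by field_simp
  linarith

/-- The quadratic form in the two currencies: `Σ_e v_e·(Av)_e = Σ_e Σ_{e′} A_{ee′} v_e v_{e′}` (the [B4] lineage's `Hyp56` writes the left-hand
side, the class theorems the right-hand side). [folklore] -/
private theorem sum_mul_mulVec_eq_sum_sum {ι : Type*} [Fintype ι] (A : Matrix ι ι ℝ) (v : ι → ℝ) :
    ∑ e, v e * A.mulVec v e = ∑ e, ∑ e', A e e' * v e * v e' := by
  simp only [Matrix.mulVec, dotProduct, Finset.mul_sum]
  exact Finset.sum_congr rfl fun e _ => Finset.sum_congr rfl fun e' _ => by ring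

/-- The inclusion `ι_Λ : Λ → □^{(j)}` of a window `Λ ⊆ □^{(j)}` into the unit box is injective. [folklore] -/
private theorem inclusion_injective {N : Fin (d + 1) → ℕ} {Λ : Finset (B1Eq324BenfattoLemma.Site (d + 1))} (hΛ : Λ ⊆ boxDom N) :
    Function.Injective (fun y : ↥Λ => (⟨(y : B1Eq324BenfattoLemma.Site (d + 1)), hΛ y.2⟩ : ↥(boxDom N))) := by
  intro a b h
  have h' : ((⟨(a : B1Eq324BenfattoLemma.Site (d + 1)), hΛ a.2⟩ : ↥(boxDom N)) : B1Eq324BenfattoLemma.Site (d + 1)) =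
      ((⟨(b : B1Eq324BenfattoLemma.Site (d + 1)), hΛ b.2⟩ : ↥(boxDom N)) : B1Eq324BenfattoLemma.Site (d + 1)) :=
    congrArg Subtype.val h
  exact Subtype.ext h'

/-! ## §2  The member: `(Δ^{(j)}(□) + aL^{-2}P)|_Λ` is symmetric, uniformly elliptic and exponentially decaying, uniformly in the step -/

/-- ★★ **[B4]'s BOX FLUCTUATION PRECISION IS A CLASS MEMBER, UNIFORMLY IN THE STEP.**  For every dimension `d + 1`, block size `L = ℓ + 1 ≥ 2` and
parameter window `a_j ∈ [a₋, a₊]` (`a₋ > 0`), `m_j² ∈ [0, m²₊]`, `a ∈ [a₂₋, a₂₊]` (`a₂₋ > 0`) there are `γ_A > 0`, `K_A ≥ 0`, `κ_A > 0` — read from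
`(d, ℓ, window)` ONLY — such that for EVERY `n ≥ 1` (`n = L^j`), every admissible `(a_j, m_j², a)`, every box `□` of unit side lengths `L·M′_μ`
(`M′_μ ≥ 1`) and EVERY window `Λ ⊆ □^{(j)}`, the compression `A_Λ := (Δ^{(j)}(□) + aL^{-2}P)|_Λ` (p. 573 (1.13) «X|_Λ = ΛXΛ», typed
`covOpSub n ℓ a_j a m_j² M′ ι_Λ : Matrix Λ Λ ℝ`) is symmetric, `γ_A`-coercive (`γ_A Σ_e x_e² ≤ Σ_{e,e′} (A_Λ)_{ee′} x_e x_{e′}`) and has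
`|(A_Λ)_{ee′}| ≤ K_A e^{−κ_A|e−e′|₂}` — the three member rows of the class road's `eq324_kernel_of_expDecay(_on_unit)`.
Proof: `B4BoxCov237.covOp_hyp56` (symmetry, the (1.15) coercivity `γ₀` from the block Poincaré inequality, sup-norm entry decay of
`Δ^{(j)}(□) + aL^{-2}P`, all window-uniform) passes to every compression (`B4Sect5Torus.hyp56_submatrix`); §1 converts the currencies
(`κ_A = κ/√(d+1)`).
[cite: Balaban1983RegularityDecay, p. 573 (1.13)–(1.14), p. 574 Proposition 2.3 (1.15); BenfattoEtAl1978, Appendix C 1) (C.2) p.164 (class form; ours);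
Balaban1985BackgroundPropagators, Sect. E p.428 (class form; ours)] -/
theorem boxFluctuation_classMember (d ℓ : ℕ) (hℓ : 1 ≤ ℓ) (aminus aplus m2plus a2minus a2plus : ℝ) (ha : 0 < aminus)
    (ha2 : 0 < a2minus) :
    ∃ γA KA κA : ℝ, 0 < γA ∧ 0 ≤ KA ∧ 0 < κA ∧
      ∀ (n : ℕ), 1 ≤ n → ∀ (a₁ m2 a₂ : ℝ), aminus ≤ a₁ → a₁ ≤ aplus → 0 ≤ m2 → m2 ≤ m2plus →
        a2minus ≤ a₂ → a₂ ≤ a2plus → ∀ (M' : Fin (d + 1) → ℕ), (∀ i, 1 ≤ M' i) →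
          ∀ (Λ : Finset (B1Eq324BenfattoLemma.Site (d + 1))) (hΛ : Λ ⊆ boxDom (fun i => (ℓ + 1) * M' i)),
            (∀ e e' : ↥Λ,
                covOpSub n ℓ a₁ a₂ m2 M'
                    (fun y : ↥Λ => (⟨(y : B1Eq324BenfattoLemma.Site (d + 1)), hΛ y.2⟩ : ↥(boxDom (fun i => (ℓ + 1) * M' i)))) e e' =
                  covOpSub n ℓ a₁ a₂ m2 M'
                    (fun y : ↥Λ => (⟨(y : B1Eq324BenfattoLemma.Site (d + 1)), hΛ y.2⟩ : ↥(boxDom (fun i => (ℓ + 1) * M' i)))) e' e) ∧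
            (∀ x : ↥Λ → ℝ, γA * ∑ e, x e ^ 2 ≤
                ∑ e, ∑ e', covOpSub n ℓ a₁ a₂ m2 M'
                    (fun y : ↥Λ => (⟨(y : B1Eq324BenfattoLemma.Site (d + 1)), hΛ y.2⟩ : ↥(boxDom (fun i => (ℓ + 1) * M' i)))) e e' *
                  x e * x e') ∧
            (∀ e e' : ↥Λ,
                |covOpSub n ℓ a₁ a₂ m2 M'
                    (fun y : ↥Λ => (⟨(y : B1Eq324BenfattoLemma.Site (d + 1)), hΛ y.2⟩ : ↥(boxDom (fun i => (ℓ + 1) * M' i)))) e e'| ≤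
                  KA * Real.exp (-(κA * Real.sqrt (∑ j,
                    ((((e : B1Eq324BenfattoLemma.Site (d + 1)) j : ℝ) - ((e' : B1Eq324BenfattoLemma.Site (d + 1)) j : ℝ))) ^ 2)))) := by
  obtain ⟨γ₀, c₀, κ₀, hγ, hc, hκ₀, -, hA⟩ := covOp_hyp56 d ℓ hℓ aminus aplus m2plus a2minus a2plus ha ha2
  refine ⟨γ₀, c₀, κ₀ / Real.sqrt (d + 1), hγ, hc, by positivity, ?_⟩
  intro n hn a₁ m2 a₂ h1 h2 h3 h4 h5 h6 M' hM Λ hΛ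
  have hAe := hyp56_submatrix (hA n hn a₁ m2 a₂ h1 h2 h3 h4 h5 h6 M' hM) (inclusion_injective hΛ)
  refine ⟨fun e e' => hAe.1.apply e' e, fun x => ?_, fun e e' => ?_⟩
  · rw [← sum_mul_mulVec_eq_sum_sum]
    exact hAe.2.1 x
  · refine (hAe.2.2 e e').trans ?_
    exact mul_le_mul_of_nonneg_left (exp_neg_supNorm_le_exp_neg_euclid hκ₀.le _ _) hc

/-! ## §3  B1 (3.24) for the Gaussian field of `C_Λ^{(j)}(□)`, every step, box, window and coupling -/

/-- ★★★ **[Balaban1982Higgs1] (3.24) FOR THE BOX FLUCTUATION COVARIANCE OF [Balaban1983RegularityDecay] (1.13) AT ZERO BACKGROUND, AT EVERY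
COUPLING `η ∈ (0,1]`.**  For every dimension `d + 1`, block size `L = ℓ + 1 ≥ 2`, window (`a₋ > 0`, `a₂₋ > 0`), order `t`, degree `D`, tree rate
`ϰ > 0` and rate letters `p₀ > 2/3`, `σ > 0`, `c ≥ 0`, `0 < κ < σ(t+1)` there is a threshold window `b₁` such that for every `b₀ > b₁` there is
`C ≥ 0` with: for EVERY `η ∈ (0,1]`, EVERY step (`n = L^j ≥ 1`), every admissible `(a_j, m_j², a)`, every box `□` (`M′_μ ≥ 1`), EVERY non-empty
window `Λ ⊆ □^{(j)}`, the Gaussian field `𝒩(0, K)` of the covariance `K` = `C_Λ^{(j)}(□) = ((Δ^{(j)}(□) + aL^{-2}P)|_Λ)^{-1}` extended by zero off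
`Λ`, and every `(s, J ⊆ I, J ⊆ Λ, 𝔄)` with `I ≠ ∅` and `sup|𝔄| ≤ c·η^σ`:
`0 < ∫Π_{Δ∈I}χ̂_{p(η)} e^{H_J} d𝒩(0,K)` and `|log ∫Π_{Δ∈I}χ̂_{p(η)} e^{H_J} d𝒩(0,K) − Σ_{k≤t}𝓔^T(H_J;k)/k!| ≤ C·η^κ·|I|`
— seat n08-b's `…KernelEq324AnyGammaUnitRange.eq324_kernel_of_expDecay_on_unit` at dimension `d + 1`, its member hypotheses discharged by §2
(constants uniform in `j`, the box and `Λ`).  The interaction is the road's generic (4.5)-Hamiltonian; the window `b₁ < b₀` is displayed.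
[cite: Balaban1982Higgs1, (3.24) p.616; Balaban1983RegularityDecay, p. 573 (1.13), p. 574 Proposition 2.3 (1.15)–(1.16); BenfattoEtAl1978,
Lemma (4.5)–(4.7) p.152, Appendix C (C.1)–(C.2) p.164; Balaban1985UV3, (7) p.257; Balaban1985BackgroundPropagators, Sect. E p.428 (class form; ours)] -/
theorem eq324_boxFluctuation_on_unit (d ℓ : ℕ) (hℓ : 1 ≤ ℓ) (aminus aplus m2plus a2minus a2plus : ℝ) (ha : 0 < aminus)
    (ha2 : 0 < a2minus) (t D : ℕ) {ϰ : ℝ} (hϰ : 0 < ϰ) {p₀ σ c κ : ℝ} (hp₀ : 2 / 3 < p₀) (hσ : 0 < σ) (hc : 0 ≤ c)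
    (hκ : 0 < κ) (hκσ : κ < σ * (t + 1)) :
    ∃ b₁ : ℝ, ∀ b₀ : ℝ, b₁ < b₀ → ∃ C : ℝ, 0 ≤ C ∧ ∀ η : ℝ, 0 < η → η ≤ 1 →
      ∀ (n : ℕ), 1 ≤ n → ∀ (a₁ m2 a₂ : ℝ), aminus ≤ a₁ → a₁ ≤ aplus → 0 ≤ m2 → m2 ≤ m2plus →
        a2minus ≤ a₂ → a₂ ≤ a2plus → ∀ (M' : Fin (d + 1) → ℕ), (∀ i, 1 ≤ M' i) →
          ∀ (Λ : Finset (B1Eq324BenfattoLemma.Site (d + 1))) (hΛ : Λ ⊆ boxDom (fun i => (ℓ + 1) * M' i))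
            {K : B1Eq324BenfattoLemma.Site (d + 1) → B1Eq324BenfattoLemma.Site (d + 1) → ℝ},
            (∀ x y, K x y = if h : x ∈ Λ ∧ y ∈ Λ then
                ((covOpSub n ℓ a₁ a₂ m2 M'
                    (fun y : ↥Λ => (⟨(y : B1Eq324BenfattoLemma.Site (d + 1)), hΛ y.2⟩ :
                      ↥(boxDom (fun i => (ℓ + 1) * M' i)))))⁻¹ : Matrix ↥Λ ↥Λ ℝ) ⟨x, h.1⟩ ⟨y, h.2⟩ else 0) →
            Λ.Nonempty →
            ∀ (s : ℕ) (I J : Finset (B1Eq324BenfattoLemma.Site (d + 1))) (a : Coef (d + 1)), I.Nonempty → J ⊆ I → J ⊆ Λ →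
              coefSup s D a J ≤ c * η ^ σ →
              0 < ∫ z, cutoffBoltzmann (hamiltonian s D ϰ a J) I (B10.pFun b₀ p₀ η) z ∂gaussianFieldOfKernel K ∧
                |Real.log (∫ z, cutoffBoltzmann (hamiltonian s D ϰ a J) I (B10.pFun b₀ p₀ η) z ∂gaussianFieldOfKernel K) -
                    cumulantSum (gaussianFieldOfKernel K) (hamiltonian s D ϰ a J) t| ≤ C * η ^ κ * I.card := by
  obtain ⟨γA, KA, κA, hγA, hKA, hκA, hmem⟩ :=
    boxFluctuation_classMember d ℓ hℓ aminus aplus m2plus a2minus a2plus ha ha2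
  obtain ⟨b₁, hb₁⟩ :=
    eq324_kernel_of_expDecay_on_unit (d := d + 1) (Nat.succ_pos d) hγA hKA hκA t D hϰ hp₀ hσ hc hκ hκσ
  refine ⟨b₁, fun b₀ hb₀ => ?_⟩
  obtain ⟨C, hC, hE⟩ := hb₁ b₀ hb₀
  refine ⟨C, hC, fun η hη hη1 n hn a₁ m2 a₂ h1 h2 h3 h4 h5 h6 M' hM Λ hΛ K hK hΛne s I J a hI hJI hJΛ hA => ?_⟩
  obtain ⟨hs, hco, hde⟩ := hmem n hn a₁ m2 a₂ h1 h2 h3 h4 h5 h6 M' hM Λ hΛ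
  exact hE η hη hη1 hK hΛne hs hco hde s I J a hI hJI hJΛ hA

/-- ★★★ **(3.24) FOR THE BOX FLUCTUATION COVARIANCE — THE `η₀`-WINDOW EDITION.**  Same data, with a fixed `b₀ > 0`: `∃ η₀ ∈ (0,1], C ≥ 0` such that
for every `η ∈ (0, η₀]`, every step, admissible parameters, box, non-empty window `Λ ⊆ □^{(j)}`, `K` = `C_Λ^{(j)}(□)` extended by zero, and every
`(s, J ⊆ I, J ⊆ Λ, 𝔄)` with `I ≠ ∅`, `sup|𝔄| ≤ c·η^σ`: the same (3.24) pair — seat n08-b's `…KernelEq324AnyGamma.eq324_kernel_of_expDecay` at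
dimension `d + 1`, member hypotheses discharged by §2.
[cite: Balaban1982Higgs1, (3.24) p.616; Balaban1983RegularityDecay, p. 573 (1.13), p. 574 Proposition 2.3 (1.15)–(1.16); BenfattoEtAl1978,
Lemma (4.5)–(4.7) p.152; Balaban1985BackgroundPropagators, Sect. E p.428 (class form; ours)] -/
theorem eq324_boxFluctuation (d ℓ : ℕ) (hℓ : 1 ≤ ℓ) (aminus aplus m2plus a2minus a2plus : ℝ) (ha : 0 < aminus)
    (ha2 : 0 < a2minus) (t D : ℕ) {ϰ : ℝ} (hϰ : 0 < ϰ) {b₀ p₀ σ c κ : ℝ} (hb₀ : 0 < b₀) (hp₀ : 2 / 3 < p₀) (hσ : 0 < σ)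
    (hc : 0 ≤ c) (hκ : 0 < κ) (hκσ : κ < σ * (t + 1)) :
    ∃ η₀ C : ℝ, 0 < η₀ ∧ η₀ ≤ 1 ∧ 0 ≤ C ∧ ∀ η : ℝ, 0 < η → η ≤ η₀ →
      ∀ (n : ℕ), 1 ≤ n → ∀ (a₁ m2 a₂ : ℝ), aminus ≤ a₁ → a₁ ≤ aplus → 0 ≤ m2 → m2 ≤ m2plus →
        a2minus ≤ a₂ → a₂ ≤ a2plus → ∀ (M' : Fin (d + 1) → ℕ), (∀ i, 1 ≤ M' i) →
          ∀ (Λ : Finset (B1Eq324BenfattoLemma.Site (d + 1))) (hΛ : Λ ⊆ boxDom (fun i => (ℓ + 1) * M' i))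
            {K : B1Eq324BenfattoLemma.Site (d + 1) → B1Eq324BenfattoLemma.Site (d + 1) → ℝ},
            (∀ x y, K x y = if h : x ∈ Λ ∧ y ∈ Λ then
                ((covOpSub n ℓ a₁ a₂ m2 M'
                    (fun y : ↥Λ => (⟨(y : B1Eq324BenfattoLemma.Site (d + 1)), hΛ y.2⟩ :
                      ↥(boxDom (fun i => (ℓ + 1) * M' i)))))⁻¹ : Matrix ↥Λ ↥Λ ℝ) ⟨x, h.1⟩ ⟨y, h.2⟩ else 0) →
            Λ.Nonempty →
            ∀ (s : ℕ) (I J : Finset (B1Eq324BenfattoLemma.Site (d + 1))) (a : Coef (d + 1)), I.Nonempty → J ⊆ I → J ⊆ Λ →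
              coefSup s D a J ≤ c * η ^ σ →
              0 < ∫ z, cutoffBoltzmann (hamiltonian s D ϰ a J) I (B10.pFun b₀ p₀ η) z ∂gaussianFieldOfKernel K ∧
                |Real.log (∫ z, cutoffBoltzmann (hamiltonian s D ϰ a J) I (B10.pFun b₀ p₀ η) z ∂gaussianFieldOfKernel K) -
                    cumulantSum (gaussianFieldOfKernel K) (hamiltonian s D ϰ a J) t| ≤ C * η ^ κ * I.card := by
  obtain ⟨γA, KA, κA, hγA, hKA, hκA, hmem⟩ :=
    boxFluctuation_classMember d ℓ hℓ aminus aplus m2plus a2minus a2plus ha ha2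
  obtain ⟨η₀, C, hη₀, hη₀1, hC, hE⟩ :=
    eq324_kernel_of_expDecay (d := d + 1) (Nat.succ_pos d) hγA hKA hκA t D hϰ hb₀ hp₀ hσ hc hκ hκσ
  refine ⟨η₀, C, hη₀, hη₀1, hC, fun η hη hηle n hn a₁ m2 a₂ h1 h2 h3 h4 h5 h6 M' hM Λ hΛ K hK hΛne s I J a hI hJI hJΛ hA => ?_⟩
  obtain ⟨hs, hco, hde⟩ := hmem n hn a₁ m2 a₂ h1 h2 h3 h4 h5 h6 M' hM Λ hΛ
  exact hE η hη hηle hK hΛne hs hco hde s I J a hI hJI hJΛ hA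

/-! ## §4  The covariance column: `C_Λ^{(j)}(□)` is symmetric, elliptic, bounded and exponentially decaying, uniformly in the step -/

/-- An upper quadratic-form bound `⟨ω, Aω⟩ ≤ γ₁‖ω‖²` passes to every compression `A|_Λ = ΛAΛ` along an injection `e` (tested on the extension
by zero; the twin of `B4Sect5Torus.hyp56_submatrix`'s lower bound). [folklore] -/
private theorem submatrix_form_le_of_form_le {ν m : Type*} [Fintype ν] [Fintype m] {A : Matrix ν ν ℝ} {γ₁ : ℝ}
    (hA : ∀ ω : ν → ℝ, ω ⬝ᵥ A.mulVec ω ≤ γ₁ * (ω ⬝ᵥ ω)) {e : m → ν} (he : Function.Injective e) (v : m → ℝ) :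
    v ⬝ᵥ (A.submatrix e e).mulVec v ≤ γ₁ * (v ⬝ᵥ v) := by
  classical
  set w : ν → ℝ := Function.extend e v 0 with hw
  have hwe : ∀ i, w (e i) = v i := fun i => he.extend_apply _ _ _
  have hw0 : ∀ p, (¬ ∃ i, e i = p) → w p = 0 := fun p hp => by
    rw [hw, Function.extend_apply' _ _ _ hp, Pi.zero_apply]
  have e1 : w ⬝ᵥ w = v ⬝ᵥ v := by
    show ∑ p, w p * w p = ∑ i, v i * v i
    rw [sum_eq_sum_range he (fun p => w p * w p) (fun p hp => by rw [hw0 p hp, mul_zero])]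
    simp only [hwe]
  have e2 : ∀ p, A.mulVec w p = ∑ j, A p (e j) * v j := by
    intro p
    simp only [Matrix.mulVec, dotProduct]
    rw [sum_eq_sum_range he (fun q => A p q * w q) (fun q hq => by rw [hw0 q hq, mul_zero])]
    simp only [hwe]
  have e3 : w ⬝ᵥ A.mulVec w = v ⬝ᵥ (A.submatrix e e).mulVec v := by
    show ∑ p, w p * A.mulVec w p = ∑ i, v i * (A.submatrix e e).mulVec v i
    rw [sum_eq_sum_range he (fun p => w p * A.mulVec w p) (fun p hp => by rw [hw0 p hp, zero_mul])]
    apply Finset.sum_congr rfl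
    intro i _
    rw [hwe, e2]
    simp [Matrix.mulVec, dotProduct, Matrix.submatrix_apply]
  rw [← e1, ← e3]
  exact hA w

/-- ★★ **THE COVARIANCE COLUMN'S ROWS FOR `C_Λ^{(j)}(□)`, UNIFORMLY IN THE STEP** ((1.15)–(1.16)|_Λ at `A = 0` in class currency).  For every
dimension `d + 1`, block size `L = ℓ + 1 ≥ 2` and window there are scalars `g > 0`, `Λ_G > 0`, `K_G ≥ 0`, `κ_G > 0` — from `(d, ℓ, window)` ONLY —
such that for EVERY `n ≥ 1`, admissible `(a_j, m_j², a)`, box `M′` and window `Λ ⊆ □^{(j)}`, with `A_Λ := (Δ^{(j)}(□) + aL^{-2}P)|_Λ` and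
`G_Λ := A_Λ⁻¹ = C_Λ^{(j)}(□)`: `A_Λ·G_Λ = 1` (the genuine inverse), `G_Λ` is symmetric, `g`-coercive (`g Σ_e x_e² ≤ Σ_{e,e′} (G_Λ)_{ee′} x_e x_{e′}`),
`Λ_G`-bounded (`Σ_{e,e′} (G_Λ)_{ee′} x_e x_{e′} ≤ Λ_G Σ_e x_e²`) and `|(G_Λ)_{ee′}| ≤ K_G e^{−κ_G|e−e′|₂}` — the four covariance-side hypotheses of seat
n08-w5's `…ClassEntryFromCovarianceUniform.eq324_covariance_of_expDecay(_on_unit)`.  Proof: the form bounds `γ₀ ≤ A ≤ γ₁` of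
`B4BoxCov237.covOp_hyp56` / `cov237_box_form_bounds` pass to the compression (`hyp56_submatrix`, `submatrix_form_le_of_form_le`) and invert
(`GaussianToolkit.inv_form_bounds`: `γ₁⁻¹ ≤ A⁻¹ ≤ γ₀⁻¹`); invertibility and the decay are `B4BoxCov237.cov116_box_sub_decay` ((1.16) for `Ω = □`,
every `Λ`), its sup-norm rate `δ` read in `|·|₂` as `δ/√(d+1)` (§1).
[cite: Balaban1983RegularityDecay, p. 573 (1.13), p. 574 Proposition 2.3 (1.15)–(1.16), p. 582 Lemma 2.4 (2.37); Balaban1985UV3, p.261 «a covariance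
having an exponential decay property»; BenfattoEtAl1978, Appendix C 1) (C.2)–(C.5) p.164 (class form; ours)] -/
theorem boxFluctuation_classCovariance (d ℓ : ℕ) (hℓ : 1 ≤ ℓ) (aminus aplus m2plus a2minus a2plus : ℝ) (ha : 0 < aminus)
    (ha2 : 0 < a2minus) :
    ∃ g ΛG KG κG : ℝ, 0 < g ∧ 0 < ΛG ∧ 0 ≤ KG ∧ 0 < κG ∧
      ∀ (n : ℕ), 1 ≤ n → ∀ (a₁ m2 a₂ : ℝ), aminus ≤ a₁ → a₁ ≤ aplus → 0 ≤ m2 → m2 ≤ m2plus →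
        a2minus ≤ a₂ → a₂ ≤ a2plus → ∀ (M' : Fin (d + 1) → ℕ), (∀ i, 1 ≤ M' i) →
          ∀ (Λ : Finset (B1Eq324BenfattoLemma.Site (d + 1))) (hΛ : Λ ⊆ boxDom (fun i => (ℓ + 1) * M' i)),
            covOpSub n ℓ a₁ a₂ m2 M'
                  (fun y : ↥Λ => (⟨(y : B1Eq324BenfattoLemma.Site (d + 1)), hΛ y.2⟩ : ↥(boxDom (fun i => (ℓ + 1) * M' i)))) *
                (covOpSub n ℓ a₁ a₂ m2 M'
                  (fun y : ↥Λ => (⟨(y : B1Eq324BenfattoLemma.Site (d + 1)), hΛ y.2⟩ : ↥(boxDom (fun i => (ℓ + 1) * M' i)))))⁻¹ = 1 ∧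
            (∀ e e' : ↥Λ,
                ((covOpSub n ℓ a₁ a₂ m2 M'
                    (fun y : ↥Λ => (⟨(y : B1Eq324BenfattoLemma.Site (d + 1)), hΛ y.2⟩ :
                      ↥(boxDom (fun i => (ℓ + 1) * M' i)))))⁻¹ : Matrix ↥Λ ↥Λ ℝ) e e' =
                  ((covOpSub n ℓ a₁ a₂ m2 M'
                    (fun y : ↥Λ => (⟨(y : B1Eq324BenfattoLemma.Site (d + 1)), hΛ y.2⟩ :
                      ↥(boxDom (fun i => (ℓ + 1) * M' i)))))⁻¹ : Matrix ↥Λ ↥Λ ℝ) e' e) ∧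
            (∀ x : ↥Λ → ℝ, g * ∑ e, x e ^ 2 ≤
                ∑ e, ∑ e', ((covOpSub n ℓ a₁ a₂ m2 M'
                    (fun y : ↥Λ => (⟨(y : B1Eq324BenfattoLemma.Site (d + 1)), hΛ y.2⟩ :
                      ↥(boxDom (fun i => (ℓ + 1) * M' i)))))⁻¹ : Matrix ↥Λ ↥Λ ℝ) e e' * x e * x e') ∧
            (∀ x : ↥Λ → ℝ,
                ∑ e, ∑ e', ((covOpSub n ℓ a₁ a₂ m2 M'
                    (fun y : ↥Λ => (⟨(y : B1Eq324BenfattoLemma.Site (d + 1)), hΛ y.2⟩ :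
                      ↥(boxDom (fun i => (ℓ + 1) * M' i)))))⁻¹ : Matrix ↥Λ ↥Λ ℝ) e e' * x e * x e' ≤
                  ΛG * ∑ e, x e ^ 2) ∧
            (∀ e e' : ↥Λ,
                |((covOpSub n ℓ a₁ a₂ m2 M'
                    (fun y : ↥Λ => (⟨(y : B1Eq324BenfattoLemma.Site (d + 1)), hΛ y.2⟩ :
                      ↥(boxDom (fun i => (ℓ + 1) * M' i)))))⁻¹ : Matrix ↥Λ ↥Λ ℝ) e e'| ≤
                  KG * Real.exp (-(κG * Real.sqrt (∑ j,
                    ((((e : B1Eq324BenfattoLemma.Site (d + 1)) j : ℝ) - ((e' : B1Eq324BenfattoLemma.Site (d + 1)) j : ℝ))) ^ 2)))) := by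
  obtain ⟨γ₀, c₀, κ₀, hγ, hc, hκ₀, -, hA⟩ := covOp_hyp56 d ℓ hℓ aminus aplus m2plus a2minus a2plus ha ha2
  obtain ⟨γ₀', γ₁, hγ', hγ'₁, hB⟩ := cov237_box_form_bounds d ℓ hℓ aminus aplus a2minus a2plus ha ha2
  obtain ⟨δ, c₁, hδ, hc₁, hD⟩ := cov116_box_sub_decay d ℓ hℓ aminus aplus m2plus a2minus a2plus ha ha2
  have hγ₁ : 0 < γ₁ := lt_of_lt_of_le hγ' hγ'₁
  refine ⟨γ₁⁻¹, γ₀⁻¹, c₁, δ / Real.sqrt (d + 1), inv_pos.mpr hγ₁, inv_pos.mpr hγ, hc₁.le, by positivity, ?_⟩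
  intro n hn a₁ m2 a₂ h1 h2 h3 h4 h5 h6 M' hM Λ hΛ
  have hι := inclusion_injective (N := fun i => (ℓ + 1) * M' i) hΛ
  have hAe := hyp56_submatrix (hA n hn a₁ m2 a₂ h1 h2 h3 h4 h5 h6 M' hM) hι
  obtain ⟨hmul, hdec⟩ := hD n hn a₁ m2 a₂ h1 h2 h3 h4 h5 h6 M' hM _ hι
  set A : Matrix ↥Λ ↥Λ ℝ := covOpSub n ℓ a₁ a₂ m2 M'
    (fun y : ↥Λ => (⟨(y : B1Eq324BenfattoLemma.Site (d + 1)), hΛ y.2⟩ : ↥(boxDom (fun i => (ℓ + 1) * M' i)))) with hAdef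
  -- the member rows of §2 for this `A`: entrywise symmetry, class-shape coercivity
  have hAs : ∀ e e' : ↥Λ, A e e' = A e' e := fun e e' => hAe.1.apply e' e
  have hco : ∀ x : ↥Λ → ℝ, γ₀ * ∑ e, x e ^ 2 ≤ ∑ e, ∑ e', A e e' * x e * x e' := fun x => by
    rw [← sum_mul_mulVec_eq_sum_sum]
    exact hAe.2.1 x
  have hPD : A.PosDef := posDef_of_coercive hAs hγ hco
  -- the form bounds of `A` in the toolkit's currency
  have hnorm : ∀ v : ↥Λ → ℝ, ‖(WithLp.toLp 2 v : EuclideanSpace ℝ ↥Λ)‖ ^ 2 = ∑ e, v e ^ 2 := fun v => by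
    rw [EuclideanSpace.real_norm_sq_eq]
  have hform : ∀ (M : Matrix ↥Λ ↥Λ ℝ) (v : ↥Λ → ℝ), v ⬝ᵥ (M *ᵥ v) = ∑ e, ∑ e', M e e' * v e * v e' := fun M v => by
    rw [← sum_mul_mulVec_eq_sum_sum]
    rfl
  have hvv : ∀ v : ↥Λ → ℝ, v ⬝ᵥ v = ∑ e, v e ^ 2 := fun v => by
    unfold dotProduct
    exact Finset.sum_congr rfl fun e _ => by ring
  have hlow : ∀ v : ↥Λ → ℝ, γ₀ * ‖(WithLp.toLp 2 v : EuclideanSpace ℝ ↥Λ)‖ ^ 2 ≤ v ⬝ᵥ A *ᵥ v := fun v => by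
    rw [hnorm, hform]
    exact hco v
  have hup : ∀ v : ↥Λ → ℝ, v ⬝ᵥ A *ᵥ v ≤ γ₁ * ‖(WithLp.toLp 2 v : EuclideanSpace ℝ ↥Λ)‖ ^ 2 := fun v => by
    rw [hnorm, ← hvv]
    exact submatrix_form_le_of_form_le (fun ω => (hB n hn a₁ m2 a₂ h1 h2 h3 h5 h6 M' hM ω).2) hι v
  refine ⟨hmul, fun e e' => inv_symm_of_coercive hAs hγ hco e e', fun x => ?_, fun x => ?_, fun e e' => ?_⟩
  · have h := (inv_form_bounds hPD hγ hlow hup x).1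
    rw [hnorm, hform] at h
    exact h
  · have h := (inv_form_bounds hPD hγ hlow hup x).2
    rw [hnorm, hform] at h
    exact h
  · refine (hdec e e').trans ?_
    exact mul_le_mul_of_nonneg_left (exp_neg_supNorm_le_exp_neg_euclid hδ.le _ _) hc₁.le

/-- ★★ **(3.24) FOR THE BOX FLUCTUATION COVARIANCE THROUGH THE COVARIANCE DOOR** — the conclusion of §3's `eq324_boxFluctuation_on_unit`
re-derived from §4's covariance rows by seat n08-w5's `…ClassEntryFromCovarianceUniform.eq324_covariance_of_expDecay_on_unit` (whose `hK` binder is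
the zero-extension of `G_Λ = A_Λ⁻¹`, i.e. the SAME kernel as §3): the precision door (§2–§3) and the covariance door agree on `C_Λ^{(j)}(□)`.
[cite: Balaban1982Higgs1, (3.24) p.616; Balaban1983RegularityDecay, p. 573 (1.13), p. 574 Proposition 2.3 (1.15)–(1.16); Balaban1985UV3, p.261
«a covariance having an exponential decay property»; BenfattoEtAl1978, Lemma (4.5)–(4.7) p.152, Appendix C (C.2) p.164;
Balaban1985BackgroundPropagators, Sect. E p.428 (class form; ours)] -/
theorem eq324_boxFluctuation_cov_on_unit (d ℓ : ℕ) (hℓ : 1 ≤ ℓ) (aminus aplus m2plus a2minus a2plus : ℝ) (ha : 0 < aminus)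
    (ha2 : 0 < a2minus) (t D : ℕ) {ϰ : ℝ} (hϰ : 0 < ϰ) {p₀ σ c κ : ℝ} (hp₀ : 2 / 3 < p₀) (hσ : 0 < σ) (hc : 0 ≤ c)
    (hκ : 0 < κ) (hκσ : κ < σ * (t + 1)) :
    ∃ b₁ : ℝ, ∀ b₀ : ℝ, b₁ < b₀ → ∃ C : ℝ, 0 ≤ C ∧ ∀ η : ℝ, 0 < η → η ≤ 1 →
      ∀ (n : ℕ), 1 ≤ n → ∀ (a₁ m2 a₂ : ℝ), aminus ≤ a₁ → a₁ ≤ aplus → 0 ≤ m2 → m2 ≤ m2plus →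
        a2minus ≤ a₂ → a₂ ≤ a2plus → ∀ (M' : Fin (d + 1) → ℕ), (∀ i, 1 ≤ M' i) →
          ∀ (Λ : Finset (B1Eq324BenfattoLemma.Site (d + 1))) (hΛ : Λ ⊆ boxDom (fun i => (ℓ + 1) * M' i))
            {K : B1Eq324BenfattoLemma.Site (d + 1) → B1Eq324BenfattoLemma.Site (d + 1) → ℝ},
            (∀ x y, K x y = if h : x ∈ Λ ∧ y ∈ Λ then
                ((covOpSub n ℓ a₁ a₂ m2 M'
                    (fun y : ↥Λ => (⟨(y : B1Eq324BenfattoLemma.Site (d + 1)), hΛ y.2⟩ :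
                      ↥(boxDom (fun i => (ℓ + 1) * M' i)))))⁻¹ : Matrix ↥Λ ↥Λ ℝ) ⟨x, h.1⟩ ⟨y, h.2⟩ else 0) →
            Λ.Nonempty →
            ∀ (s : ℕ) (I J : Finset (B1Eq324BenfattoLemma.Site (d + 1))) (a : Coef (d + 1)), I.Nonempty → J ⊆ I → J ⊆ Λ →
              coefSup s D a J ≤ c * η ^ σ →
              0 < ∫ z, cutoffBoltzmann (hamiltonian s D ϰ a J) I (B10.pFun b₀ p₀ η) z ∂gaussianFieldOfKernel K ∧
                |Real.log (∫ z, cutoffBoltzmann (hamiltonian s D ϰ a J) I (B10.pFun b₀ p₀ η) z ∂gaussianFieldOfKernel K) -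
                    cumulantSum (gaussianFieldOfKernel K) (hamiltonian s D ϰ a J) t| ≤ C * η ^ κ * I.card := by
  obtain ⟨g, ΛG, KG, κG, hg, hΛG, hKG, hκG, hcov⟩ :=
    boxFluctuation_classCovariance d ℓ hℓ aminus aplus m2plus a2minus a2plus ha ha2
  obtain ⟨b₁, hb₁⟩ :=
    eq324_covariance_of_expDecay_on_unit (d := d + 1) (Nat.succ_pos d) hg hΛG hKG hκG t D hϰ hp₀ hσ hc hκ hκσ
  refine ⟨b₁, fun b₀ hb₀ => ?_⟩
  obtain ⟨C, hC, hE⟩ := hb₁ b₀ hb₀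
  refine ⟨C, hC, fun η hη hη1 n hn a₁ m2 a₂ h1 h2 h3 h4 h5 h6 M' hM Λ hΛ K hK hΛne s I J a hI hJI hJΛ hA => ?_⟩
  obtain ⟨-, hGs, hGco, hGbd, hGdec⟩ := hcov n hn a₁ m2 a₂ h1 h2 h3 h4 h5 h6 M' hM Λ hΛ
  exact hE η hη hη1 hK hΛne hGs hGco hGbd hGdec s I J a hI hJI hJΛ hA

/-! ## Non-vacuity at the physical dimension -/

/-- non-vacuity at `d + 1 = 4`, `L = 2`, window `a_j ∈ [½, 2]`, `m_j² ∈ [0, 1]`, `a ∈ [½, 2]`: the member rows exist with genuine constants and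
apply to every step `j`, every box and every window `Λ`. -/
example : ∃ γA KA κA : ℝ, 0 < γA ∧ 0 ≤ KA ∧ 0 < κA ∧
    ∀ (n : ℕ), 1 ≤ n → ∀ (a₁ m2 a₂ : ℝ), (1 / 2 : ℝ) ≤ a₁ → a₁ ≤ 2 → 0 ≤ m2 → m2 ≤ 1 →
      (1 / 2 : ℝ) ≤ a₂ → a₂ ≤ 2 → ∀ (M' : Fin (3 + 1) → ℕ), (∀ i, 1 ≤ M' i) →
        ∀ (Λ : Finset (B1Eq324BenfattoLemma.Site (3 + 1))) (hΛ : Λ ⊆ boxDom (fun i => (1 + 1) * M' i)),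
          (∀ e e' : ↥Λ,
              covOpSub n 1 a₁ a₂ m2 M'
                  (fun y : ↥Λ => (⟨(y : B1Eq324BenfattoLemma.Site (3 + 1)), hΛ y.2⟩ : ↥(boxDom (fun i => (1 + 1) * M' i)))) e e' =
                covOpSub n 1 a₁ a₂ m2 M'
                  (fun y : ↥Λ => (⟨(y : B1Eq324BenfattoLemma.Site (3 + 1)), hΛ y.2⟩ : ↥(boxDom (fun i => (1 + 1) * M' i)))) e' e) ∧
          (∀ x : ↥Λ → ℝ, γA * ∑ e, x e ^ 2 ≤
              ∑ e, ∑ e', covOpSub n 1 a₁ a₂ m2 M'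
                  (fun y : ↥Λ => (⟨(y : B1Eq324BenfattoLemma.Site (3 + 1)), hΛ y.2⟩ : ↥(boxDom (fun i => (1 + 1) * M' i)))) e e' *
                x e * x e') ∧
          (∀ e e' : ↥Λ,
              |covOpSub n 1 a₁ a₂ m2 M'
                  (fun y : ↥Λ => (⟨(y : B1Eq324BenfattoLemma.Site (3 + 1)), hΛ y.2⟩ : ↥(boxDom (fun i => (1 + 1) * M' i)))) e e'| ≤
                KA * Real.exp (-(κA * Real.sqrt (∑ j,
                  ((((e : B1Eq324BenfattoLemma.Site (3 + 1)) j : ℝ) - ((e' : B1Eq324BenfattoLemma.Site (3 + 1)) j : ℝ))) ^ 2)))) :=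
  boxFluctuation_classMember 3 1 le_rfl (1 / 2) 2 1 (1 / 2) 2 (by norm_num) (by norm_num)

/-- non-vacuity of §3 at `d + 1 = 4`, `L = 2`, the window above and the d = 3 lane's letters `t = 6`, `D = 4`, `ϰ = 1`, `p₀ = 1`, `σ = ½`,
`c = 1`, `κ = 13/4 < ½·7`: the threshold window `b₁` and the constant exist, and (3.24) is a genuine statement about the Gaussian field of
`C_Λ^{(j)}(□)` for every `j`, box, `Λ` and `η ∈ (0,1]`. -/
example : ∃ b₁ : ℝ, ∀ b₀ : ℝ, b₁ < b₀ → ∃ C : ℝ, 0 ≤ C ∧ ∀ η : ℝ, 0 < η → η ≤ 1 →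
    ∀ (n : ℕ), 1 ≤ n → ∀ (a₁ m2 a₂ : ℝ), (1 / 2 : ℝ) ≤ a₁ → a₁ ≤ 2 → 0 ≤ m2 → m2 ≤ 1 →
      (1 / 2 : ℝ) ≤ a₂ → a₂ ≤ 2 → ∀ (M' : Fin (3 + 1) → ℕ), (∀ i, 1 ≤ M' i) →
        ∀ (Λ : Finset (B1Eq324BenfattoLemma.Site (3 + 1))) (hΛ : Λ ⊆ boxDom (fun i => (1 + 1) * M' i))
          {K : B1Eq324BenfattoLemma.Site (3 + 1) → B1Eq324BenfattoLemma.Site (3 + 1) → ℝ},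
          (∀ x y, K x y = if h : x ∈ Λ ∧ y ∈ Λ then
              ((covOpSub n 1 a₁ a₂ m2 M'
                  (fun y : ↥Λ => (⟨(y : B1Eq324BenfattoLemma.Site (3 + 1)), hΛ y.2⟩ :
                    ↥(boxDom (fun i => (1 + 1) * M' i)))))⁻¹ : Matrix ↥Λ ↥Λ ℝ) ⟨x, h.1⟩ ⟨y, h.2⟩ else 0) →
          Λ.Nonempty →
          ∀ (s : ℕ) (I J : Finset (B1Eq324BenfattoLemma.Site (3 + 1))) (a : Coef (3 + 1)), I.Nonempty → J ⊆ I → J ⊆ Λ →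
            coefSup s 4 a J ≤ 1 * η ^ (1 / 2 : ℝ) →
            0 < ∫ z, cutoffBoltzmann (hamiltonian s 4 1 a J) I (B10.pFun b₀ 1 η) z ∂gaussianFieldOfKernel K ∧
              |Real.log (∫ z, cutoffBoltzmann (hamiltonian s 4 1 a J) I (B10.pFun b₀ 1 η) z ∂gaussianFieldOfKernel K) -
                  cumulantSum (gaussianFieldOfKernel K) (hamiltonian s 4 1 a J) 6| ≤ C * η ^ (13 / 4 : ℝ) * I.card :=
  eq324_boxFluctuation_on_unit 3 1 le_rfl (1 / 2) 2 1 (1 / 2) 2 (by norm_num) (by norm_num) 6 4 one_pos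
    (by norm_num) (by norm_num) zero_le_one (by norm_num) (by norm_num)

end Literature.MathematicalPhysics.QuantumFieldTheory.Balaban1983to89.B1Eq324BenfattoClassBoxFluctuation
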